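import Summits.NavierStokesRegularity.NavierStokesRegularity.Theorems.ExtremiserTransienceNearExtremalTransienceExtremiserLiouvilleConstantSpeedSlidePalinstrophyFrobenius
import HarnessLib

/-!
# Crux `ExtremiserTransience.NearExtremalTransience` (stmt-NavierStokesRegularity-21883), line `extremiser_liouville`,
# stub K1b — THE WEIGHTED `L⁴` INTERPOLATION OF THE ABSORPTION LEDGER R6b (record §3/§15: `∫γ|DV|⁴ ≤ Cσ²(∫γ|D²V|² + L⁻²∫γ|DV|²)`)

`--supports stmt-NavierStokesRegularity-21883` (helper).  Author: prover seat `ns-el-k1b` (g9).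

R6b needs the quartic gradient term (from `|∇∇_hV₂|² ≤ 2(|DV|⁴ + σ²|D²V|²)/M²`, `…SlideJetKinematics`) absorbed on the layer where
`‖V‖ ≤ σ`.  This file proves the weighted Gagliardo–Nirenberg-type inequality by the divergence-certificate method: with
`S = Σₖ‖∂ₖV‖² = |DV|²_F` and the flux `X = Σₖ γ(x₂)·S·⟪V, ∂ₖV⟫·eₖ` (integrable when `DV` is bounded and square integrable),
`div X = γS² + R`, `|R| ≤ ½γS² + 3(σ/L)²γS + 81σ²γ‖D²V‖²` pointwise (`|γ′| ≤ γ/L`, `‖V‖ ≤ σ` on `supp γ`), so `∫div X = 0` gives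
```
  ∫γ(x₂)|DV|⁴_F ≤ 6(σ/L)²∫γ(x₂)|DV|²_F + 162σ²∫γ(x₂)‖D²V‖².
```
* `divergence_sum_smul_basisFun` : `div(Σₖ fₖeₖ) = Σₖ ∂ₖfₖ`;
* `fderiv_gnFluxCoeff_apply` : the derivative of `γ(x₂)·S·⟪V,∂ₖV⟫`;
* `integral_axialWeight_frobeniusNormSq_sq_le` : the displayed inequality.

WHAT THIS IS NOT: K1b is NOT proved; nothing here proves NS regularity. [folklore]
-/

noncomputable section

open Set Filter Topology MeasureTheory Metric Function InnerProductSpace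
open scoped ENNReal NNReal Topology InnerProductSpace RealInnerProductSpace ContDiff
open Literature.Analysis.FluidPDE Literature.Analysis

namespace Summit.NavierStokesRegularity.NavierStokesRegularity.Theorems

-- the problem directory repeats the summit name (`NavierStokesRegularity/NavierStokesRegularity`)
set_option linter.dupNamespace false

namespace ExtremiserLiouville

open DepletionLadder.KStar

variable {V : EuclideanSpace ℝ (Fin 3) → EuclideanSpace ℝ (Fin 3)} {γ : ℝ → ℝ}

/-! ## 1. Divergence of a field given in coordinates -/

/-- `div(Σₖ fₖ·eₖ)(x) = Σₖ Dfₖ(x)eₖ` for differentiable coefficients `fₖ`. [folklore] -/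
theorem divergence_sum_smul_basisFun {f : Fin 3 → EuclideanSpace ℝ (Fin 3) → ℝ} {x : EuclideanSpace ℝ (Fin 3)} (hf : ∀ k, DifferentiableAt ℝ (f k) x) :
    VectorCalculus.divergence (fun y => ∑ k : Fin 3, f k y • EuclideanSpace.basisFun (Fin 3) ℝ k) x = ∑ k : Fin 3, fderiv ℝ (f k) x (EuclideanSpace.basisFun (Fin 3) ℝ k) := by
  have h : HasFDerivAt (fun y => ∑ k : Fin 3, f k y • EuclideanSpace.basisFun (Fin 3) ℝ k)
      (∑ k : Fin 3, (fderiv ℝ (f k) x).smulRight (EuclideanSpace.basisFun (Fin 3) ℝ k)) x :=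
    HasFDerivAt.fun_sum fun k _ => (hf k).hasFDerivAt.smul_const _
  rw [divergence_eq_traceCLM, h.fderiv, map_sum]
  exact Finset.sum_congr rfl fun k _ => traceCLM_smulRight _ _

/-! ## 2. The flux coefficient and its derivative -/

/-- **Derivative of the flux coefficient** `fₖ = γ(x₂)·S·⟪V, ∂ₖV⟫`, `S = Σₘ⟪∂ₘV, ∂ₘV⟫`, in the direction `eₖ` (`V ∈ C²`, `γ ∈ C¹`). [folklore] -/
theorem fderiv_gnFluxCoeff_apply (hV : ContDiff ℝ 2 V) (hγ : ContDiff ℝ 1 γ) (x : EuclideanSpace ℝ (Fin 3)) (k : Fin 3) :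
    fderiv ℝ (fun y => (γ (y 2) * ((∑ m : Fin 3, ⟪fderiv ℝ V y (EuclideanSpace.basisFun (Fin 3) ℝ m), fderiv ℝ V y (EuclideanSpace.basisFun (Fin 3) ℝ m)⟫) * ⟪V y, fderiv ℝ V y (EuclideanSpace.basisFun (Fin 3) ℝ k)⟫))) x (EuclideanSpace.basisFun (Fin 3) ℝ k) =
      (deriv γ (x 2) * (EuclideanSpace.basisFun (Fin 3) ℝ k) 2) * ((∑ m : Fin 3, ⟪fderiv ℝ V x (EuclideanSpace.basisFun (Fin 3) ℝ m), fderiv ℝ V x (EuclideanSpace.basisFun (Fin 3) ℝ m)⟫) * ⟪V x, fderiv ℝ V x (EuclideanSpace.basisFun (Fin 3) ℝ k)⟫) + γ (x 2) * ((∑ m : Fin 3, (⟪fderiv ℝ V x (EuclideanSpace.basisFun (Fin 3) ℝ m), fderiv ℝ (fun z => fderiv ℝ V z (EuclideanSpace.basisFun (Fin 3) ℝ m)) x (EuclideanSpace.basisFun (Fin 3) ℝ k)⟫ + ⟪fderiv ℝ (fun z => fderiv ℝ V z (EuclideanSpace.basisFun (Fin 3) ℝ m)) x (EuclideanSpace.basisFun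 (Fin 3) ℝ k), fderiv ℝ V x (EuclideanSpace.basisFun (Fin 3) ℝ m)⟫)) * ⟪V x, fderiv ℝ V x (EuclideanSpace.basisFun (Fin 3) ℝ k)⟫ + (∑ m : Fin 3, ⟪fderiv ℝ V x (EuclideanSpace.basisFun (Fin 3) ℝ m), fderiv ℝ V x (EuclideanSpace.basisFun (Fin 3) ℝ m)⟫) * (⟪V x, fderiv ℝ (fun z => fderiv ℝ V z (EuclideanSpace.basisFun (Fin 3) ℝ k)) x (EuclideanSpace.basisFun (Fin 3) ℝ k)⟫ + ⟪fderiv ℝ V x (EuclideanSpace.basisFun (Fin 3) ℝ k), fderiv ℝ V x (EuclideanSpace.basisFun (Fin 3) ℝ k)⟫)) := by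
  have hVd : Differentiable ℝ V := hV.differentiable (by norm_num)
  have hud : ∀ m : Fin 3, Differentiable ℝ fun z => fderiv ℝ V z (EuclideanSpace.basisFun (Fin 3) ℝ m) := fun m =>
    ((hV.fderiv_right (m := 1) le_rfl).clm_apply contDiff_const).differentiable one_ne_zero
  have hγd : Differentiable ℝ γ := hγ.differentiable one_ne_zero
  -- the three factors
  have hA : HasFDerivAt (fun y : EuclideanSpace ℝ (Fin 3) => γ (y 2))
      (deriv γ (x 2) • (EuclideanSpace.proj (2 : Fin 3) : EuclideanSpace ℝ (Fin 3) →L[ℝ] ℝ)) x := hasFDerivAt_comp_coord_two hγd x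
  have hS : HasFDerivAt (fun y : EuclideanSpace ℝ (Fin 3) => (∑ m : Fin 3, ⟪fderiv ℝ V y (EuclideanSpace.basisFun (Fin 3) ℝ m), fderiv ℝ V y (EuclideanSpace.basisFun (Fin 3) ℝ m)⟫))
      (∑ m : Fin 3, (fderivInnerCLM ℝ (fderiv ℝ V x (EuclideanSpace.basisFun (Fin 3) ℝ m), fderiv ℝ V x (EuclideanSpace.basisFun (Fin 3) ℝ m))).comp
        ((fderiv ℝ (fun z => fderiv ℝ V z (EuclideanSpace.basisFun (Fin 3) ℝ m)) x).prod (fderiv ℝ (fun z => fderiv ℝ V z (EuclideanSpace.basisFun (Fin 3) ℝ m)) x))) x :=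
    HasFDerivAt.fun_sum fun m _ => (hud m x).hasFDerivAt.inner ℝ (hud m x).hasFDerivAt
  have hI : HasFDerivAt (fun y : EuclideanSpace ℝ (Fin 3) => ⟪V y, fderiv ℝ V y (EuclideanSpace.basisFun (Fin 3) ℝ k)⟫)
      ((fderivInnerCLM ℝ (V x, fderiv ℝ V x (EuclideanSpace.basisFun (Fin 3) ℝ k))).comp ((fderiv ℝ V x).prod (fderiv ℝ (fun z => fderiv ℝ V z (EuclideanSpace.basisFun (Fin 3) ℝ k)) x))) x :=
    (hVd x).hasFDerivAt.inner ℝ (hud k x).hasFDerivAt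
  have h := hA.fun_mul (hS.fun_mul hI)
  rw [h.fderiv]
  simp only [add_apply, smul_apply, sum_apply, ContinuousLinearMap.comp_apply, ContinuousLinearMap.prod_apply,
    fderivInnerCLM_apply, smul_eq_mul, proj_two_apply]
  ring

/-! ## 3. The weighted `L⁴` inequality -/

set_option maxHeartbeats 400000 in
/-- **Weighted `L⁴` interpolation for the gradient (R6b).**  Let `V ∈ C^∞(ℝ³;ℝ³)` have bounded gradient and `DV, D²V ∈ L²`; let
`γ ∈ C¹(ℝ)`, `0 ≤ γ ≤ K`, `|γ′| ≤ γ/L`, and `‖V‖ ≤ σ` wherever `γ(x₂) ≠ 0`.  Then, with `|DV|²_F = Σₖ‖∂ₖV‖²`,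
`∫γ(x₂)|DV|⁴_F ≤ 6(σ/L)²∫γ(x₂)|DV|²_F + 162σ²∫γ(x₂)‖D²V‖²`. [folklore] -/
theorem integral_axialWeight_frobeniusNormSq_sq_le (hV : ContDiff ℝ ∞ V) (hγ : ContDiff ℝ 1 γ) {K L σ B : ℝ}
    (hγ0 : ∀ s, 0 ≤ γ s) (hγK : ∀ s, γ s ≤ K) (hL : 0 < L) (hγ' : ∀ s, |deriv γ s| ≤ γ s / L) (hσ0 : 0 ≤ σ)
    (hσ : ∀ x : EuclideanSpace ℝ (Fin 3), γ (x 2) ≠ 0 → ‖V x‖ ≤ σ) (hB : ∀ x, ‖fderiv ℝ V x‖ ≤ B)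
    (i1 : Integrable (fun y => ‖fderiv ℝ V y‖ ^ 2) (volume : Measure (EuclideanSpace ℝ (Fin 3))))
    (i2 : Integrable (fun y => ‖iteratedFDeriv ℝ 2 V y‖ ^ 2) (volume : Measure (EuclideanSpace ℝ (Fin 3)))) :
    (∫ x, γ (x 2) * frobeniusNormSq (fderiv ℝ V x) ^ 2) ≤
      6 * (σ / L) ^ 2 * (∫ x, γ (x 2) * frobeniusNormSq (fderiv ℝ V x)) +
        162 * σ ^ 2 * ∫ x, γ (x 2) * ‖iteratedFDeriv ℝ 2 V x‖ ^ 2 := by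
  -- `|DV|²_F` as a sum of inner squares
  have hS : ∀ x : EuclideanSpace ℝ (Fin 3), frobeniusNormSq (fderiv ℝ V x) = (∑ m : Fin 3, ⟪fderiv ℝ V x (EuclideanSpace.basisFun (Fin 3) ℝ m), fderiv ℝ V x (EuclideanSpace.basisFun (Fin 3) ℝ m)⟫) := fun x => by
    rw [frobeniusNormSq_eq_sum (EuclideanSpace.basisFun (Fin 3) ℝ)]
    exact Finset.sum_congr rfl fun m _ => (real_inner_self_eq_norm_sq _).symm
  simp_rw [hS]
  have hK0 : 0 ≤ K := (hγ0 0).trans (hγK 0)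
  have hB0 : 0 ≤ B := (norm_nonneg _).trans (hB 0)
  have lt2 : (2 : WithTop ℕ∞) ≤ ((⊤ : ℕ∞) : WithTop ℕ∞) := WithTop.coe_le_coe.mpr le_top
  have hV2 : ContDiff ℝ 2 V := hV.of_le lt2
  have lt1 : ((1 : ℕ) : WithTop ℕ∞) ≤ ((⊤ : ℕ∞) : WithTop ℕ∞) := WithTop.coe_le_coe.mpr le_top
  have nb : ∀ k : Fin 3, ‖EuclideanSpace.basisFun (Fin 3) ℝ k‖ = 1 := fun k => (EuclideanSpace.basisFun (Fin 3) ℝ).orthonormal.norm_eq_one k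
  have hu : ∀ k : Fin 3, ContDiff ℝ ∞ fun z => fderiv ℝ V z (EuclideanSpace.basisFun (Fin 3) ℝ k) := fun k =>
    (hV.fderiv_right (m := ∞) (by exact_mod_cast le_rfl)).clm_apply contDiff_const
  have hDu : ∀ k : Fin 3, ContDiff ℝ ∞ fun y => fderiv ℝ (fun z => fderiv ℝ V z (EuclideanSpace.basisFun (Fin 3) ℝ k)) y := fun k =>
    (hu k).fderiv_right (m := ∞) (by exact_mod_cast le_rfl)
  have cγ : ContDiff ℝ 1 fun y : EuclideanSpace ℝ (Fin 3) => γ (y 2) := hγ.comp (EuclideanSpace.proj (2 : Fin 3) : EuclideanSpace ℝ (Fin 3) →L[ℝ] ℝ).contDiff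
  have cγ' : Continuous fun y : EuclideanSpace ℝ (Fin 3) => deriv γ (y 2) :=
    (hγ.continuous_deriv le_rfl).comp (EuclideanSpace.proj (2 : Fin 3) : EuclideanSpace ℝ (Fin 3) →L[ℝ] ℝ).continuous
  have cS : ContDiff ℝ 1 fun y : EuclideanSpace ℝ (Fin 3) => (∑ m : Fin 3, ⟪fderiv ℝ V y (EuclideanSpace.basisFun (Fin 3) ℝ m), fderiv ℝ V y (EuclideanSpace.basisFun (Fin 3) ℝ m)⟫) := ContDiff.sum fun m _ => ((hu m).of_le lt1).inner ℝ ((hu m).of_le lt1)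
  have cI : ∀ k : Fin 3, ContDiff ℝ 1 fun y : EuclideanSpace ℝ (Fin 3) => ⟪V y, fderiv ℝ V y (EuclideanSpace.basisFun (Fin 3) ℝ k)⟫ := fun k => (hV.of_le lt1).inner ℝ ((hu k).of_le lt1)
  have cf : ∀ k : Fin 3, ContDiff ℝ 1 fun y : EuclideanSpace ℝ (Fin 3) => (γ (y 2) * ((∑ m : Fin 3, ⟪fderiv ℝ V y (EuclideanSpace.basisFun (Fin 3) ℝ m), fderiv ℝ V y (EuclideanSpace.basisFun (Fin 3) ℝ m)⟫) * ⟪V y, fderiv ℝ V y (EuclideanSpace.basisFun (Fin 3) ℝ k)⟫)) := fun k => cγ.mul (cS.mul (cI k))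
  have hX1 : ContDiff ℝ 1 fun y : EuclideanSpace ℝ (Fin 3) => ∑ k : Fin 3, (γ (y 2) * ((∑ m : Fin 3, ⟪fderiv ℝ V y (EuclideanSpace.basisFun (Fin 3) ℝ m), fderiv ℝ V y (EuclideanSpace.basisFun (Fin 3) ℝ m)⟫) * ⟪V y, fderiv ℝ V y (EuclideanSpace.basisFun (Fin 3) ℝ k)⟫)) • EuclideanSpace.basisFun (Fin 3) ℝ k := ContDiff.sum fun k _ => (cf k).smul contDiff_const
  -- pointwise norm bookkeeping
  have nu : ∀ (k : Fin 3) (x : EuclideanSpace ℝ (Fin 3)), ‖fderiv ℝ V x (EuclideanSpace.basisFun (Fin 3) ℝ k)‖ ≤ ‖fderiv ℝ V x‖ := fun k x => by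
    simpa [nb k] using (fderiv ℝ V x).le_opNorm (EuclideanSpace.basisFun (Fin 3) ℝ k)
  have nDu : ∀ (k : Fin 3) (x : EuclideanSpace ℝ (Fin 3)), ‖fderiv ℝ (fun z => fderiv ℝ V z (EuclideanSpace.basisFun (Fin 3) ℝ k)) x‖ ≤ ‖iteratedFDeriv ℝ 2 V x‖ := fun k x => by
    rw [fderiv_fderiv_apply_eq hV2 x]
    have e1 : ‖fderiv ℝ (fderiv ℝ V) x‖ = ‖iteratedFDeriv ℝ 2 V x‖ := by
      rw [← norm_iteratedFDeriv_zero (𝕜 := ℝ) (f := fderiv ℝ (fderiv ℝ V)), norm_iteratedFDeriv_fderiv,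
        norm_iteratedFDeriv_fderiv]
    rw [← e1]
    simpa [nb k] using (fderiv ℝ (fderiv ℝ V) x).le_opNorm (EuclideanSpace.basisFun (Fin 3) ℝ k)
  have nDuk : ∀ (m k : Fin 3) (x : EuclideanSpace ℝ (Fin 3)), ‖fderiv ℝ (fun z => fderiv ℝ V z (EuclideanSpace.basisFun (Fin 3) ℝ m)) x (EuclideanSpace.basisFun (Fin 3) ℝ k)‖ ≤ ‖iteratedFDeriv ℝ 2 V x‖ := fun m k x => by
    refine ((fderiv ℝ (fun z => fderiv ℝ V z (EuclideanSpace.basisFun (Fin 3) ℝ m)) x).le_opNorm _).trans ?_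
    rw [nb k, mul_one]; exact nDu m x
  have nb2 : ∀ k : Fin 3, |(EuclideanSpace.basisFun (Fin 3) ℝ k) 2| ≤ 1 := fun k => by
    have h := PiLp.norm_apply_le (p := 2) (EuclideanSpace.basisFun (Fin 3) ℝ k) 2
    rw [Real.norm_eq_abs, nb k] at h
    exact h
  have hSnn : ∀ x : EuclideanSpace ℝ (Fin 3), 0 ≤ (∑ m : Fin 3, ⟪fderiv ℝ V x (EuclideanSpace.basisFun (Fin 3) ℝ m), fderiv ℝ V x (EuclideanSpace.basisFun (Fin 3) ℝ m)⟫) := fun x => Finset.sum_nonneg fun m _ => real_inner_self_nonneg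
  have hSle : ∀ x : EuclideanSpace ℝ (Fin 3), (∑ m : Fin 3, ⟪fderiv ℝ V x (EuclideanSpace.basisFun (Fin 3) ℝ m), fderiv ℝ V x (EuclideanSpace.basisFun (Fin 3) ℝ m)⟫) ≤ 3 * ‖fderiv ℝ V x‖ ^ 2 := fun x => by
    have h : ∀ m : Fin 3, ⟪fderiv ℝ V x (EuclideanSpace.basisFun (Fin 3) ℝ m), fderiv ℝ V x (EuclideanSpace.basisFun (Fin 3) ℝ m)⟫ ≤ ‖fderiv ℝ V x‖ ^ 2 := fun m => by
      rw [real_inner_self_eq_norm_sq]; exact pow_le_pow_left₀ (norm_nonneg _) (nu m x) 2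
    calc (∑ m : Fin 3, ⟪fderiv ℝ V x (EuclideanSpace.basisFun (Fin 3) ℝ m), fderiv ℝ V x (EuclideanSpace.basisFun (Fin 3) ℝ m)⟫) ≤ ∑ m : Fin 3, ‖fderiv ℝ V x‖ ^ 2 := Finset.sum_le_sum fun m _ => h m
      _ = 3 * ‖fderiv ℝ V x‖ ^ 2 := by simp
  have hAle : ∀ x : EuclideanSpace ℝ (Fin 3), (∑ k : Fin 3, ‖fderiv ℝ V x (EuclideanSpace.basisFun (Fin 3) ℝ k)‖) ≤ 3 * ‖fderiv ℝ V x‖ := fun x => by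
    calc (∑ k : Fin 3, ‖fderiv ℝ V x (EuclideanSpace.basisFun (Fin 3) ℝ k)‖) ≤ ∑ k : Fin 3, ‖fderiv ℝ V x‖ := Finset.sum_le_sum fun k _ => nu k x
      _ = 3 * ‖fderiv ℝ V x‖ := by simp
  have hAsq : ∀ x : EuclideanSpace ℝ (Fin 3), (∑ k : Fin 3, ‖fderiv ℝ V x (EuclideanSpace.basisFun (Fin 3) ℝ k)‖) ^ 2 ≤ 3 * (∑ m : Fin 3, ⟪fderiv ℝ V x (EuclideanSpace.basisFun (Fin 3) ℝ m), fderiv ℝ V x (EuclideanSpace.basisFun (Fin 3) ℝ m)⟫) := fun x => by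
    rw [Fin.sum_univ_three, Fin.sum_univ_three, real_inner_self_eq_norm_sq, real_inner_self_eq_norm_sq, real_inner_self_eq_norm_sq]
    nlinarith [sq_nonneg (‖fderiv ℝ V x (EuclideanSpace.basisFun (Fin 3) ℝ 0)‖ - ‖fderiv ℝ V x (EuclideanSpace.basisFun (Fin 3) ℝ 1)‖), sq_nonneg (‖fderiv ℝ V x (EuclideanSpace.basisFun (Fin 3) ℝ 1)‖ - ‖fderiv ℝ V x (EuclideanSpace.basisFun (Fin 3) ℝ 2)‖),
      sq_nonneg (‖fderiv ℝ V x (EuclideanSpace.basisFun (Fin 3) ℝ 0)‖ - ‖fderiv ℝ V x (EuclideanSpace.basisFun (Fin 3) ℝ 2)‖)]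
  have huS : ∀ (k : Fin 3) (x : EuclideanSpace ℝ (Fin 3)), ‖fderiv ℝ V x (EuclideanSpace.basisFun (Fin 3) ℝ k)‖ ^ 2 ≤ (∑ m : Fin 3, ⟪fderiv ℝ V x (EuclideanSpace.basisFun (Fin 3) ℝ m), fderiv ℝ V x (EuclideanSpace.basisFun (Fin 3) ℝ m)⟫) := fun k x => by
    rw [← real_inner_self_eq_norm_sq]
    exact Finset.single_le_sum (f := fun m => ⟪fderiv ℝ V x (EuclideanSpace.basisFun (Fin 3) ℝ m), fderiv ℝ V x (EuclideanSpace.basisFun (Fin 3) ℝ m)⟫) (fun _ _ => real_inner_self_nonneg) (Finset.mem_univ k)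
  -- `‖V‖ ≤ σ` against the weight
  have gV : ∀ x : EuclideanSpace ℝ (Fin 3), γ (x 2) * ‖V x‖ ≤ γ (x 2) * σ := fun x => by
    by_cases h : γ (x 2) = 0
    · rw [h, zero_mul, zero_mul]
    · exact mul_le_mul_of_nonneg_left (hσ x h) (hγ0 _)
  have g'V : ∀ x : EuclideanSpace ℝ (Fin 3), |deriv γ (x 2)| * ‖V x‖ ≤ γ (x 2) / L * σ := fun x => by
    by_cases h : γ (x 2) = 0
    · have : |deriv γ (x 2)| ≤ 0 := by simpa [h] using hγ' (x 2)
      have h0 : |deriv γ (x 2)| = 0 := le_antisymm this (abs_nonneg _)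
      rw [h0, zero_mul, h, zero_div, zero_mul]
    · exact mul_le_mul (hγ' _) (hσ x h) (norm_nonneg _) (div_nonneg (hγ0 _) hL.le)
  -- the divergence of the flux, pointwise, and the remainder
  have hdiv : ∀ x : EuclideanSpace ℝ (Fin 3), VectorCalculus.divergence (fun y : EuclideanSpace ℝ (Fin 3) => ∑ k : Fin 3, (γ (y 2) * ((∑ m : Fin 3, ⟪fderiv ℝ V y (EuclideanSpace.basisFun (Fin 3) ℝ m), fderiv ℝ V y (EuclideanSpace.basisFun (Fin 3) ℝ m)⟫) * ⟪V y, fderiv ℝ V y (EuclideanSpace.basisFun (Fin 3) ℝ k)⟫)) • EuclideanSpace.basisFun (Fin 3) ℝ k) x = ∑ k : Fin 3, ((deriv γ (x 2) * (EuclideanSpace.basisFun (Fin 3) ℝ k) 2) * ((∑ m : Fin 3, ⟪fderiv ℝ V x (EuclideanSpace.basisFun (Fin 3) ℝ m), fderiv ℝ V x (EuclideanSpace.basisFun (Fin 3) ℝ m)⟫) * ⟪V x, fderiv ℝ V x (EuclideanSpace.basisFun (Fin 3) ℝ k)⟫) + γ (x 2) * ((∑ m : Fin 3, (⟪fderiv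 ℝ V x (EuclideanSpace.basisFun (Fin 3) ℝ m), fderiv ℝ (fun z => fderiv ℝ V z (EuclideanSpace.basisFun (Fin 3) ℝ m)) x (EuclideanSpace.basisFun (Fin 3) ℝ k)⟫ + ⟪fderiv ℝ (fun z => fderiv ℝ V z (EuclideanSpace.basisFun (Fin 3) ℝ m)) x (EuclideanSpace.basisFun (Fin 3) ℝ k), fderiv ℝ V x (EuclideanSpace.basisFun (Fin 3) ℝ m)⟫)) * ⟪V x, fderiv ℝ V x (EuclideanSpace.basisFun (Fin 3) ℝ k)⟫ + (∑ m : Fin 3, ⟪fderiv ℝ V x (EuclideanSpace.basisFun (Fin 3) ℝ m), fderiv ℝ V x (EuclideanSpace.basisFun (Fin 3) ℝ m)⟫) * (⟪V x, fderiv ℝ (fun z => fderiv ℝ V z (EuclideanSpace.basisFun (Fin 3) ℝ k)) x (EuclideanSpace.basisFun (Fin 3) ℝ k)⟫ + ⟪fderiv ℝ V x (EuclideanSpace.basisFun (Fin 3) ℝ k), fderiv ℝ V x (EuclideanSpace.basisFun (Fin 3) ℝ k)⟫))) := fun x => by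
    rw [divergence_sum_smul_basisFun fun k => ((cf k).differentiable one_ne_zero) x]
    exact Finset.sum_congr rfl fun k _ => fderiv_gnFluxCoeff_apply hV2 hγ x k
  have hrest : ∀ x : EuclideanSpace ℝ (Fin 3), VectorCalculus.divergence (fun y : EuclideanSpace ℝ (Fin 3) => ∑ k : Fin 3, (γ (y 2) * ((∑ m : Fin 3, ⟪fderiv ℝ V y (EuclideanSpace.basisFun (Fin 3) ℝ m), fderiv ℝ V y (EuclideanSpace.basisFun (Fin 3) ℝ m)⟫) * ⟪V y, fderiv ℝ V y (EuclideanSpace.basisFun (Fin 3) ℝ k)⟫)) • EuclideanSpace.basisFun (Fin 3) ℝ k) x - γ (x 2) * ((∑ m : Fin 3, ⟪fderiv ℝ V x (EuclideanSpace.basisFun (Fin 3) ℝ m), fderiv ℝ V x (EuclideanSpace.basisFun (Fin 3) ℝ m)⟫) * (∑ m : Fin 3, ⟪fderiv ℝ V x (EuclideanSpace.basisFun (Fin 3) ℝ m), fderiv ℝ V x (EuclideanSpace.basisFun (Fin 3) ℝ m)⟫)) =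
      ∑ k : Fin 3, ((deriv γ (x 2) * (EuclideanSpace.basisFun (Fin 3) ℝ k) 2) * ((∑ m : Fin 3, ⟪fderiv ℝ V x (EuclideanSpace.basisFun (Fin 3) ℝ m), fderiv ℝ V x (EuclideanSpace.basisFun (Fin 3) ℝ m)⟫) * ⟪V x, fderiv ℝ V x (EuclideanSpace.basisFun (Fin 3) ℝ k)⟫) + γ (x 2) * ((∑ m : Fin 3, (⟪fderiv ℝ V x (EuclideanSpace.basisFun (Fin 3) ℝ m), fderiv ℝ (fun z => fderiv ℝ V z (EuclideanSpace.basisFun (Fin 3) ℝ m)) x (EuclideanSpace.basisFun (Fin 3) ℝ k)⟫ + ⟪fderiv ℝ (fun z => fderiv ℝ V z (EuclideanSpace.basisFun (Fin 3) ℝ m)) x (EuclideanSpace.basisFun (Fin 3) ℝ k), fderiv ℝ V x (EuclideanSpace.basisFun (Fin 3) ℝ m)⟫)) * ⟪V x, fderiv ℝ V x (EuclideanSpace.basisFun (Fin 3) ℝ k)⟫ + (∑ m : Fin 3, ⟪fderiv ℝ V x (EuclideanSpace.basisFun (Fin 3) ℝ m), fderiv ℝ V x (EuclideanSpace.basisFun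 (Fin 3) ℝ m)⟫) * ⟪V x, fderiv ℝ (fun z => fderiv ℝ V z (EuclideanSpace.basisFun (Fin 3) ℝ k)) x (EuclideanSpace.basisFun (Fin 3) ℝ k)⟫)) := fun x => by
    rw [hdiv x, Finset.mul_sum, Finset.mul_sum, ← Finset.sum_sub_distrib]
    exact Finset.sum_congr rfl fun k _ => by ring
  -- the pointwise bound on the remainder
  have hDS : ∀ (x : EuclideanSpace ℝ (Fin 3)) (k : Fin 3), |(∑ m : Fin 3, (⟪fderiv ℝ V x (EuclideanSpace.basisFun (Fin 3) ℝ m), fderiv ℝ (fun z => fderiv ℝ V z (EuclideanSpace.basisFun (Fin 3) ℝ m)) x (EuclideanSpace.basisFun (Fin 3) ℝ k)⟫ + ⟪fderiv ℝ (fun z => fderiv ℝ V z (EuclideanSpace.basisFun (Fin 3) ℝ m)) x (EuclideanSpace.basisFun (Fin 3) ℝ k), fderiv ℝ V x (EuclideanSpace.basisFun (Fin 3) ℝ m)⟫))| ≤ 2 * ‖iteratedFDeriv ℝ 2 V x‖ * (∑ k : Fin 3, ‖fderiv ℝ V x (EuclideanSpace.basisFun (Fin 3) ℝ k)‖) :=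 fun x k => by
    rw [Finset.mul_sum]
    refine (Finset.abs_sum_le_sum_abs _ _).trans (Finset.sum_le_sum fun m _ => ?_)
    have h1 := abs_real_inner_le_norm (fderiv ℝ V x (EuclideanSpace.basisFun (Fin 3) ℝ m)) (fderiv ℝ (fun z => fderiv ℝ V z (EuclideanSpace.basisFun (Fin 3) ℝ m)) x (EuclideanSpace.basisFun (Fin 3) ℝ k))
    have h2 := abs_real_inner_le_norm (fderiv ℝ (fun z => fderiv ℝ V z (EuclideanSpace.basisFun (Fin 3) ℝ m)) x (EuclideanSpace.basisFun (Fin 3) ℝ k)) (fderiv ℝ V x (EuclideanSpace.basisFun (Fin 3) ℝ m))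
    have h3 := nDuk m k x
    have := norm_nonneg (fderiv ℝ V x (EuclideanSpace.basisFun (Fin 3) ℝ m))
    refine (abs_add_le _ _).trans ?_
    nlinarith
  have hterm : ∀ (x : EuclideanSpace ℝ (Fin 3)) (k : Fin 3), |((deriv γ (x 2) * (EuclideanSpace.basisFun (Fin 3) ℝ k) 2) * ((∑ m : Fin 3, ⟪fderiv ℝ V x (EuclideanSpace.basisFun (Fin 3) ℝ m), fderiv ℝ V x (EuclideanSpace.basisFun (Fin 3) ℝ m)⟫) * ⟪V x, fderiv ℝ V x (EuclideanSpace.basisFun (Fin 3) ℝ k)⟫) + γ (x 2) * ((∑ m : Fin 3, (⟪fderiv ℝ V x (EuclideanSpace.basisFun (Fin 3) ℝ m), fderiv ℝ (fun z => fderiv ℝ V z (EuclideanSpace.basisFun (Fin 3) ℝ m)) x (EuclideanSpace.basisFun (Fin 3) ℝ k)⟫ + ⟪fderiv ℝ (fun z => fderiv ℝ V z (EuclideanSpace.basisFun (Fin 3) ℝ m)) x (EuclideanSpace.basisFun (Fin 3) ℝ k), fderiv ℝ V x (EuclideanSpace.basisFun (Fin 3) ℝ m)⟫)) * ⟪V x,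 fderiv ℝ V x (EuclideanSpace.basisFun (Fin 3) ℝ k)⟫ + (∑ m : Fin 3, ⟪fderiv ℝ V x (EuclideanSpace.basisFun (Fin 3) ℝ m), fderiv ℝ V x (EuclideanSpace.basisFun (Fin 3) ℝ m)⟫) * ⟪V x, fderiv ℝ (fun z => fderiv ℝ V z (EuclideanSpace.basisFun (Fin 3) ℝ k)) x (EuclideanSpace.basisFun (Fin 3) ℝ k)⟫))| ≤
      γ (x 2) / L * σ * (∑ m : Fin 3, ⟪fderiv ℝ V x (EuclideanSpace.basisFun (Fin 3) ℝ m), fderiv ℝ V x (EuclideanSpace.basisFun (Fin 3) ℝ m)⟫) * ‖fderiv ℝ V x (EuclideanSpace.basisFun (Fin 3) ℝ k)‖ + 2 * (γ (x 2) * σ) * ‖iteratedFDeriv ℝ 2 V x‖ * (∑ k : Fin 3, ‖fderiv ℝ V x (EuclideanSpace.basisFun (Fin 3) ℝ k)‖) * ‖fderiv ℝ V x (EuclideanSpace.basisFun (Fin 3) ℝ k)‖ +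
        γ (x 2) * σ * (∑ m : Fin 3, ⟪fderiv ℝ V x (EuclideanSpace.basisFun (Fin 3) ℝ m), fderiv ℝ V x (EuclideanSpace.basisFun (Fin 3) ℝ m)⟫) * ‖iteratedFDeriv ℝ 2 V x‖ := fun x k => by
    have hI : |⟪V x, fderiv ℝ V x (EuclideanSpace.basisFun (Fin 3) ℝ k)⟫| ≤ ‖V x‖ * ‖fderiv ℝ V x (EuclideanSpace.basisFun (Fin 3) ℝ k)‖ := abs_real_inner_le_norm _ _
    have hJ : |⟪V x, fderiv ℝ (fun z => fderiv ℝ V z (EuclideanSpace.basisFun (Fin 3) ℝ k)) x (EuclideanSpace.basisFun (Fin 3) ℝ k)⟫| ≤ ‖V x‖ * ‖iteratedFDeriv ℝ 2 V x‖ :=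
      (abs_real_inner_le_norm _ _).trans (mul_le_mul_of_nonneg_left (nDuk k k x) (norm_nonneg _))
    have e1 : |(deriv γ (x 2) * (EuclideanSpace.basisFun (Fin 3) ℝ k) 2) * ((∑ m : Fin 3, ⟪fderiv ℝ V x (EuclideanSpace.basisFun (Fin 3) ℝ m), fderiv ℝ V x (EuclideanSpace.basisFun (Fin 3) ℝ m)⟫) * ⟪V x, fderiv ℝ V x (EuclideanSpace.basisFun (Fin 3) ℝ k)⟫)| ≤ γ (x 2) / L * σ * (∑ m : Fin 3, ⟪fderiv ℝ V x (EuclideanSpace.basisFun (Fin 3) ℝ m), fderiv ℝ V x (EuclideanSpace.basisFun (Fin 3) ℝ m)⟫) * ‖fderiv ℝ V x (EuclideanSpace.basisFun (Fin 3) ℝ k)‖ := by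
      rw [abs_mul, abs_mul, abs_mul, abs_of_nonneg (hSnn x)]
      have a1 := nb2 k; have a2 := g'V x; have a3 := hSnn x
      calc |deriv γ (x 2)| * |(EuclideanSpace.basisFun (Fin 3) ℝ k) 2| * ((∑ m : Fin 3, ⟪fderiv ℝ V x (EuclideanSpace.basisFun (Fin 3) ℝ m), fderiv ℝ V x (EuclideanSpace.basisFun (Fin 3) ℝ m)⟫) * |⟪V x, fderiv ℝ V x (EuclideanSpace.basisFun (Fin 3) ℝ k)⟫|)
          ≤ |deriv γ (x 2)| * 1 * ((∑ m : Fin 3, ⟪fderiv ℝ V x (EuclideanSpace.basisFun (Fin 3) ℝ m), fderiv ℝ V x (EuclideanSpace.basisFun (Fin 3) ℝ m)⟫) * (‖V x‖ * ‖fderiv ℝ V x (EuclideanSpace.basisFun (Fin 3) ℝ k)‖)) :=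
            mul_le_mul (mul_le_mul_of_nonneg_left a1 (abs_nonneg _)) (mul_le_mul_of_nonneg_left hI a3) (by positivity) (by positivity)
        _ = (|deriv γ (x 2)| * ‖V x‖) * (∑ m : Fin 3, ⟪fderiv ℝ V x (EuclideanSpace.basisFun (Fin 3) ℝ m), fderiv ℝ V x (EuclideanSpace.basisFun (Fin 3) ℝ m)⟫) * ‖fderiv ℝ V x (EuclideanSpace.basisFun (Fin 3) ℝ k)‖ := by ring
        _ ≤ (γ (x 2) / L * σ) * (∑ m : Fin 3, ⟪fderiv ℝ V x (EuclideanSpace.basisFun (Fin 3) ℝ m), fderiv ℝ V x (EuclideanSpace.basisFun (Fin 3) ℝ m)⟫) * ‖fderiv ℝ V x (EuclideanSpace.basisFun (Fin 3) ℝ k)‖ :=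
            mul_le_mul_of_nonneg_right (mul_le_mul_of_nonneg_right a2 a3) (norm_nonneg _)
    have e2 : |γ (x 2) * ((∑ m : Fin 3, (⟪fderiv ℝ V x (EuclideanSpace.basisFun (Fin 3) ℝ m), fderiv ℝ (fun z => fderiv ℝ V z (EuclideanSpace.basisFun (Fin 3) ℝ m)) x (EuclideanSpace.basisFun (Fin 3) ℝ k)⟫ + ⟪fderiv ℝ (fun z => fderiv ℝ V z (EuclideanSpace.basisFun (Fin 3) ℝ m)) x (EuclideanSpace.basisFun (Fin 3) ℝ k), fderiv ℝ V x (EuclideanSpace.basisFun (Fin 3) ℝ m)⟫)) * ⟪V x, fderiv ℝ V x (EuclideanSpace.basisFun (Fin 3) ℝ k)⟫ + (∑ m : Fin 3, ⟪fderiv ℝ V x (EuclideanSpace.basisFun (Fin 3) ℝ m), fderiv ℝ V x (EuclideanSpace.basisFun (Fin 3) ℝ m)⟫) * ⟪V x, fderiv ℝ (fun z => fderiv ℝ V z (EuclideanSpace.basisFun (Fin 3) ℝ k)) x (EuclideanSpace.basisFun (Fin 3) ℝ k)⟫)| ≤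
        2 * (γ (x 2) * σ) * ‖iteratedFDeriv ℝ 2 V x‖ * (∑ k : Fin 3, ‖fderiv ℝ V x (EuclideanSpace.basisFun (Fin 3) ℝ k)‖) * ‖fderiv ℝ V x (EuclideanSpace.basisFun (Fin 3) ℝ k)‖ + γ (x 2) * σ * (∑ m : Fin 3, ⟪fderiv ℝ V x (EuclideanSpace.basisFun (Fin 3) ℝ m), fderiv ℝ V x (EuclideanSpace.basisFun (Fin 3) ℝ m)⟫) * ‖iteratedFDeriv ℝ 2 V x‖ := by
      rw [abs_mul, abs_of_nonneg (hγ0 _)]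
      have a2 := gV x; have a3 := hSnn x; have a4 := hDS x k; have a5 := hγ0 (x 2)
      have hA0 : 0 ≤ (∑ k : Fin 3, ‖fderiv ℝ V x (EuclideanSpace.basisFun (Fin 3) ℝ k)‖) := Finset.sum_nonneg fun k _ => norm_nonneg _
      calc γ (x 2) * |(∑ m : Fin 3, (⟪fderiv ℝ V x (EuclideanSpace.basisFun (Fin 3) ℝ m), fderiv ℝ (fun z => fderiv ℝ V z (EuclideanSpace.basisFun (Fin 3) ℝ m)) x (EuclideanSpace.basisFun (Fin 3) ℝ k)⟫ + ⟪fderiv ℝ (fun z => fderiv ℝ V z (EuclideanSpace.basisFun (Fin 3) ℝ m)) x (EuclideanSpace.basisFun (Fin 3) ℝ k), fderiv ℝ V x (EuclideanSpace.basisFun (Fin 3) ℝ m)⟫)) * ⟪V x, fderiv ℝ V x (EuclideanSpace.basisFun (Fin 3) ℝ k)⟫ + (∑ m : Fin 3, ⟪fderiv ℝ V x (EuclideanSpace.basisFun (Fin 3) ℝ m), fderiv ℝ V x (EuclideanSpace.basisFun (Fin 3) ℝ m)⟫) * ⟪V x, fderiv ℝ (fun z => fderiv ℝ V z (EuclideanSpace.basisFun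 (Fin 3) ℝ k)) x (EuclideanSpace.basisFun (Fin 3) ℝ k)⟫|
          ≤ γ (x 2) * ((2 * ‖iteratedFDeriv ℝ 2 V x‖ * (∑ k : Fin 3, ‖fderiv ℝ V x (EuclideanSpace.basisFun (Fin 3) ℝ k)‖)) * (‖V x‖ * ‖fderiv ℝ V x (EuclideanSpace.basisFun (Fin 3) ℝ k)‖) + (∑ m : Fin 3, ⟪fderiv ℝ V x (EuclideanSpace.basisFun (Fin 3) ℝ m), fderiv ℝ V x (EuclideanSpace.basisFun (Fin 3) ℝ m)⟫) * (‖V x‖ * ‖iteratedFDeriv ℝ 2 V x‖)) := by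
            refine mul_le_mul_of_nonneg_left ((abs_add_le _ _).trans (add_le_add ?_ ?_)) a5
            · rw [abs_mul]; exact mul_le_mul a4 hI (abs_nonneg _) (by positivity)
            · rw [abs_mul, abs_of_nonneg a3]; exact mul_le_mul_of_nonneg_left hJ a3
        _ = (γ (x 2) * ‖V x‖) * (2 * ‖iteratedFDeriv ℝ 2 V x‖ * (∑ k : Fin 3, ‖fderiv ℝ V x (EuclideanSpace.basisFun (Fin 3) ℝ k)‖) * ‖fderiv ℝ V x (EuclideanSpace.basisFun (Fin 3) ℝ k)‖ + (∑ m : Fin 3, ⟪fderiv ℝ V x (EuclideanSpace.basisFun (Fin 3) ℝ m), fderiv ℝ V x (EuclideanSpace.basisFun (Fin 3) ℝ m)⟫) * ‖iteratedFDeriv ℝ 2 V x‖) := by ring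
        _ ≤ (γ (x 2) * σ) * (2 * ‖iteratedFDeriv ℝ 2 V x‖ * (∑ k : Fin 3, ‖fderiv ℝ V x (EuclideanSpace.basisFun (Fin 3) ℝ k)‖) * ‖fderiv ℝ V x (EuclideanSpace.basisFun (Fin 3) ℝ k)‖ + (∑ m : Fin 3, ⟪fderiv ℝ V x (EuclideanSpace.basisFun (Fin 3) ℝ m), fderiv ℝ V x (EuclideanSpace.basisFun (Fin 3) ℝ m)⟫) * ‖iteratedFDeriv ℝ 2 V x‖) :=
            mul_le_mul_of_nonneg_right a2 (by positivity)
        _ = 2 * (γ (x 2) * σ) * ‖iteratedFDeriv ℝ 2 V x‖ * (∑ k : Fin 3, ‖fderiv ℝ V x (EuclideanSpace.basisFun (Fin 3) ℝ k)‖) * ‖fderiv ℝ V x (EuclideanSpace.basisFun (Fin 3) ℝ k)‖ + γ (x 2) * σ * (∑ m : Fin 3, ⟪fderiv ℝ V x (EuclideanSpace.basisFun (Fin 3) ℝ m), fderiv ℝ V x (EuclideanSpace.basisFun (Fin 3) ℝ m)⟫) * ‖iteratedFDeriv ℝ 2 V x‖ := by ring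
    exact (abs_add_le _ _).trans (add_le_add e1 e2) |>.trans (le_of_eq (by ring))
  have hRest : ∀ x : EuclideanSpace ℝ (Fin 3), |VectorCalculus.divergence (fun y : EuclideanSpace ℝ (Fin 3) => ∑ k : Fin 3, (γ (y 2) * ((∑ m : Fin 3, ⟪fderiv ℝ V y (EuclideanSpace.basisFun (Fin 3) ℝ m), fderiv ℝ V y (EuclideanSpace.basisFun (Fin 3) ℝ m)⟫) * ⟪V y, fderiv ℝ V y (EuclideanSpace.basisFun (Fin 3) ℝ k)⟫)) • EuclideanSpace.basisFun (Fin 3) ℝ k) x - γ (x 2) * ((∑ m : Fin 3, ⟪fderiv ℝ V x (EuclideanSpace.basisFun (Fin 3) ℝ m), fderiv ℝ V x (EuclideanSpace.basisFun (Fin 3) ℝ m)⟫) * (∑ m : Fin 3, ⟪fderiv ℝ V x (EuclideanSpace.basisFun (Fin 3) ℝ m), fderiv ℝ V x (EuclideanSpace.basisFun (Fin 3) ℝ m)⟫))| ≤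
      (1 / 2) * (γ (x 2) * ((∑ m : Fin 3, ⟪fderiv ℝ V x (EuclideanSpace.basisFun (Fin 3) ℝ m), fderiv ℝ V x (EuclideanSpace.basisFun (Fin 3) ℝ m)⟫) * (∑ m : Fin 3, ⟪fderiv ℝ V x (EuclideanSpace.basisFun (Fin 3) ℝ m), fderiv ℝ V x (EuclideanSpace.basisFun (Fin 3) ℝ m)⟫))) + (3 * (σ / L) ^ 2 * (γ (x 2) * (∑ m : Fin 3, ⟪fderiv ℝ V x (EuclideanSpace.basisFun (Fin 3) ℝ m), fderiv ℝ V x (EuclideanSpace.basisFun (Fin 3) ℝ m)⟫)) + 81 * σ ^ 2 * (γ (x 2) * ‖iteratedFDeriv ℝ 2 V x‖ ^ 2)) := fun x => by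
    rw [hrest x]
    refine (Finset.abs_sum_le_sum_abs _ _).trans ((Finset.sum_le_sum fun k _ => hterm x k).trans ?_)
    rw [Finset.sum_add_distrib, Finset.sum_add_distrib, ← Finset.mul_sum, ← Finset.mul_sum, Finset.sum_const, Finset.card_univ,
      Fintype.card_fin]
    simp only [nsmul_eq_mul, Nat.cast_ofNat]
    have a1 := hAsq x; have a2 := hSnn x; have a3 := hγ0 (x 2)
    have hA0 : 0 ≤ (∑ k : Fin 3, ‖fderiv ℝ V x (EuclideanSpace.basisFun (Fin 3) ℝ k)‖) := Finset.sum_nonneg fun k _ => norm_nonneg _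
    have hQ0 : 0 ≤ ‖iteratedFDeriv ℝ 2 V x‖ := norm_nonneg _
    -- Young: `(σ/L)·A·S ≤ ¼S² + (σ/L)²A² ≤ ¼S² + 3(σ/L)²S` and `9σ·S·Q ≤ ¼S² + 81σ²Q²`
    have y1 : σ / L * (∑ k : Fin 3, ‖fderiv ℝ V x (EuclideanSpace.basisFun (Fin 3) ℝ k)‖) * (∑ m : Fin 3, ⟪fderiv ℝ V x (EuclideanSpace.basisFun (Fin 3) ℝ m), fderiv ℝ V x (EuclideanSpace.basisFun (Fin 3) ℝ m)⟫) ≤ (1 / 4) * ((∑ m : Fin 3, ⟪fderiv ℝ V x (EuclideanSpace.basisFun (Fin 3) ℝ m), fderiv ℝ V x (EuclideanSpace.basisFun (Fin 3) ℝ m)⟫) * (∑ m : Fin 3, ⟪fderiv ℝ V x (EuclideanSpace.basisFun (Fin 3) ℝ m), fderiv ℝ V x (EuclideanSpace.basisFun (Fin 3) ℝ m)⟫)) + 3 * (σ / L) ^ 2 * (∑ m : Fin 3, ⟪fderiv ℝ V x (EuclideanSpace.basisFun (Fin 3) ℝ m), fderiv ℝ V x (EuclideanSpace.basisFun (Fin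 3) ℝ m)⟫) := by
      nlinarith [sq_nonneg ((∑ m : Fin 3, ⟪fderiv ℝ V x (EuclideanSpace.basisFun (Fin 3) ℝ m), fderiv ℝ V x (EuclideanSpace.basisFun (Fin 3) ℝ m)⟫) / 2 - σ / L * (∑ k : Fin 3, ‖fderiv ℝ V x (EuclideanSpace.basisFun (Fin 3) ℝ k)‖)), mul_nonneg (sq_nonneg (σ / L)) (sub_nonneg.2 a1)]
    have y2 : 9 * σ * (∑ m : Fin 3, ⟪fderiv ℝ V x (EuclideanSpace.basisFun (Fin 3) ℝ m), fderiv ℝ V x (EuclideanSpace.basisFun (Fin 3) ℝ m)⟫) * ‖iteratedFDeriv ℝ 2 V x‖ ≤ (1 / 4) * ((∑ m : Fin 3, ⟪fderiv ℝ V x (EuclideanSpace.basisFun (Fin 3) ℝ m), fderiv ℝ V x (EuclideanSpace.basisFun (Fin 3) ℝ m)⟫) * (∑ m : Fin 3, ⟪fderiv ℝ V x (EuclideanSpace.basisFun (Fin 3) ℝ m), fderiv ℝ V x (EuclideanSpace.basisFun (Fin 3) ℝ m)⟫)) + 81 * σ ^ 2 * ‖iteratedFDeriv ℝ 2 V x‖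 ^ 2 := by
      nlinarith [sq_nonneg ((∑ m : Fin 3, ⟪fderiv ℝ V x (EuclideanSpace.basisFun (Fin 3) ℝ m), fderiv ℝ V x (EuclideanSpace.basisFun (Fin 3) ℝ m)⟫) / 2 - 9 * σ * ‖iteratedFDeriv ℝ 2 V x‖)]
    have y3 : 2 * (γ (x 2) * σ) * ‖iteratedFDeriv ℝ 2 V x‖ * ((∑ k : Fin 3, ‖fderiv ℝ V x (EuclideanSpace.basisFun (Fin 3) ℝ k)‖) * (∑ k : Fin 3, ‖fderiv ℝ V x (EuclideanSpace.basisFun (Fin 3) ℝ k)‖)) ≤ 6 * (γ (x 2) * σ) * ‖iteratedFDeriv ℝ 2 V x‖ * (∑ m : Fin 3, ⟪fderiv ℝ V x (EuclideanSpace.basisFun (Fin 3) ℝ m), fderiv ℝ V x (EuclideanSpace.basisFun (Fin 3) ℝ m)⟫) := by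
      have : (∑ k : Fin 3, ‖fderiv ℝ V x (EuclideanSpace.basisFun (Fin 3) ℝ k)‖) * (∑ k : Fin 3, ‖fderiv ℝ V x (EuclideanSpace.basisFun (Fin 3) ℝ k)‖) ≤ 3 * (∑ m : Fin 3, ⟪fderiv ℝ V x (EuclideanSpace.basisFun (Fin 3) ℝ m), fderiv ℝ V x (EuclideanSpace.basisFun (Fin 3) ℝ m)⟫) := by nlinarith [a1]
      have h0 : 0 ≤ 2 * (γ (x 2) * σ) * ‖iteratedFDeriv ℝ 2 V x‖ := by positivity
      nlinarith [mul_le_mul_of_nonneg_left this h0]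
    have y1' := mul_le_mul_of_nonneg_left y1 a3
    have y2' := mul_le_mul_of_nonneg_left y2 a3
    set Sx := (∑ m : Fin 3, ⟪fderiv ℝ V x (EuclideanSpace.basisFun (Fin 3) ℝ m), fderiv ℝ V x (EuclideanSpace.basisFun (Fin 3) ℝ m)⟫) with hSx
    set Ax := (∑ k : Fin 3, ‖fderiv ℝ V x (EuclideanSpace.basisFun (Fin 3) ℝ k)‖) with hAx
    set Qx := ‖iteratedFDeriv ℝ 2 V x‖ with hQx
    set gx := γ (x 2) with hgx
    have e1 : gx / L * σ * Sx * Ax = gx * (σ / L * Ax * Sx) := by ring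
    have e2 : (3 : ℝ) * (σ / L) ^ 2 * (gx * Sx) = gx * (3 * (σ / L) ^ 2 * Sx) := by ring
    have e3 : (81 : ℝ) * σ ^ 2 * (gx * Qx ^ 2) = gx * (81 * σ ^ 2 * Qx ^ 2) := by ring
    have e4 : (1 / 2 : ℝ) * (gx * (Sx * Sx)) = gx * ((1 / 4) * (Sx * Sx)) + gx * ((1 / 4) * (Sx * Sx)) := by ring
    have e5 : (3 : ℝ) * (gx * σ * Sx * Qx) + 6 * (gx * σ) * Qx * Sx = gx * (9 * σ * Sx * Qx) := by ring
    rw [e1, e2, e3, e4]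
    linarith [y1', y2', y3, e5]
  -- hence, pointwise, `½γS² ≤ div X + G`
  have half : ∀ x : EuclideanSpace ℝ (Fin 3), (1 / 2) * (γ (x 2) * ((∑ m : Fin 3, ⟪fderiv ℝ V x (EuclideanSpace.basisFun (Fin 3) ℝ m), fderiv ℝ V x (EuclideanSpace.basisFun (Fin 3) ℝ m)⟫) * (∑ m : Fin 3, ⟪fderiv ℝ V x (EuclideanSpace.basisFun (Fin 3) ℝ m), fderiv ℝ V x (EuclideanSpace.basisFun (Fin 3) ℝ m)⟫))) ≤
      VectorCalculus.divergence (fun y : EuclideanSpace ℝ (Fin 3) => ∑ k : Fin 3, (γ (y 2) * ((∑ m : Fin 3, ⟪fderiv ℝ V y (EuclideanSpace.basisFun (Fin 3) ℝ m), fderiv ℝ V y (EuclideanSpace.basisFun (Fin 3) ℝ m)⟫) * ⟪V y, fderiv ℝ V y (EuclideanSpace.basisFun (Fin 3) ℝ k)⟫)) • EuclideanSpace.basisFun (Fin 3) ℝ k) x + (3 * (σ / L) ^ 2 * (γ (x 2) * (∑ m : Fin 3, ⟪fderiv ℝ V x (EuclideanSpace.basisFun (Fin 3) ℝ m), fderiv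 ℝ V x (EuclideanSpace.basisFun (Fin 3) ℝ m)⟫)) + 81 * σ ^ 2 * (γ (x 2) * ‖iteratedFDeriv ℝ 2 V x‖ ^ 2)) := fun x => by
    have h := (abs_le.mp (hRest x)).1
    linarith
  -- integrability
  have cSx : Continuous fun x : EuclideanSpace ℝ (Fin 3) => (∑ m : Fin 3, ⟪fderiv ℝ V x (EuclideanSpace.basisFun (Fin 3) ℝ m), fderiv ℝ V x (EuclideanSpace.basisFun (Fin 3) ℝ m)⟫) := cS.continuous
  have cQ : Continuous fun x : EuclideanSpace ℝ (Fin 3) => ‖iteratedFDeriv ℝ 2 V x‖ := (hV.continuous_iteratedFDeriv (WithTop.coe_le_coe.mpr le_top)).norm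
  have hPB : ∀ x : EuclideanSpace ℝ (Fin 3), ‖fderiv ℝ V x‖ ^ 2 ≤ B ^ 2 := fun x => pow_le_pow_left₀ (norm_nonneg _) (hB x) 2
  have iXk : ∀ k : Fin 3, Integrable (fun y : EuclideanSpace ℝ (Fin 3) => (γ (y 2) * ((∑ m : Fin 3, ⟪fderiv ℝ V y (EuclideanSpace.basisFun (Fin 3) ℝ m), fderiv ℝ V y (EuclideanSpace.basisFun (Fin 3) ℝ m)⟫) * ⟪V y, fderiv ℝ V y (EuclideanSpace.basisFun (Fin 3) ℝ k)⟫)) • EuclideanSpace.basisFun (Fin 3) ℝ k) volume := fun k => by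
    refine (i1.const_mul (3 * K * σ * B)).mono' ((cf k).continuous.smul continuous_const).aestronglyMeasurable
      (Eventually.of_forall fun x => ?_)
    rw [norm_smul, nb k, mul_one, Real.norm_eq_abs, abs_mul, abs_mul, abs_of_nonneg (hγ0 _), abs_of_nonneg (hSnn x)]
    have a1 := gV x; have a2 := hSle x; have a3 := nu k x; have a4 := hB x; have a5 := hγK (x 2); have a6 := hγ0 (x 2)
    have hI : |⟪V x, fderiv ℝ V x (EuclideanSpace.basisFun (Fin 3) ℝ k)⟫| ≤ ‖V x‖ * ‖fderiv ℝ V x (EuclideanSpace.basisFun (Fin 3) ℝ k)‖ := abs_real_inner_le_norm _ _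
    have hP := norm_nonneg (fderiv ℝ V x)
    calc γ (x 2) * ((∑ m : Fin 3, ⟪fderiv ℝ V x (EuclideanSpace.basisFun (Fin 3) ℝ m), fderiv ℝ V x (EuclideanSpace.basisFun (Fin 3) ℝ m)⟫) * |⟪V x, fderiv ℝ V x (EuclideanSpace.basisFun (Fin 3) ℝ k)⟫|)
        ≤ γ (x 2) * ((∑ m : Fin 3, ⟪fderiv ℝ V x (EuclideanSpace.basisFun (Fin 3) ℝ m), fderiv ℝ V x (EuclideanSpace.basisFun (Fin 3) ℝ m)⟫) * (‖V x‖ * ‖fderiv ℝ V x (EuclideanSpace.basisFun (Fin 3) ℝ k)‖)) :=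
          mul_le_mul_of_nonneg_left (mul_le_mul_of_nonneg_left hI (hSnn x)) a6
      _ = (γ (x 2) * ‖V x‖) * ((∑ m : Fin 3, ⟪fderiv ℝ V x (EuclideanSpace.basisFun (Fin 3) ℝ m), fderiv ℝ V x (EuclideanSpace.basisFun (Fin 3) ℝ m)⟫) * ‖fderiv ℝ V x (EuclideanSpace.basisFun (Fin 3) ℝ k)‖) := by ring
      _ ≤ (γ (x 2) * σ) * ((3 * ‖fderiv ℝ V x‖ ^ 2) * ‖fderiv ℝ V x‖) :=
          mul_le_mul a1 (mul_le_mul a2 a3 (norm_nonneg _) (by positivity)) (mul_nonneg (hSnn x) (norm_nonneg _)) (by positivity)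
      _ ≤ (K * σ) * ((3 * ‖fderiv ℝ V x‖ ^ 2) * B) :=
          mul_le_mul (mul_le_mul_of_nonneg_right a5 hσ0) (mul_le_mul_of_nonneg_left a4 (by positivity)) (by positivity) (by positivity)
      _ = 3 * K * σ * B * ‖fderiv ℝ V x‖ ^ 2 := by ring
  have iX : Integrable (fun y : EuclideanSpace ℝ (Fin 3) => ∑ k : Fin 3, (γ (y 2) * ((∑ m : Fin 3, ⟪fderiv ℝ V y (EuclideanSpace.basisFun (Fin 3) ℝ m), fderiv ℝ V y (EuclideanSpace.basisFun (Fin 3) ℝ m)⟫) * ⟪V y, fderiv ℝ V y (EuclideanSpace.basisFun (Fin 3) ℝ k)⟫)) • EuclideanSpace.basisFun (Fin 3) ℝ k) volume := integrable_finsetSum _ fun k _ => iXk k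
  have iSS : Integrable (fun x : EuclideanSpace ℝ (Fin 3) => γ (x 2) * ((∑ m : Fin 3, ⟪fderiv ℝ V x (EuclideanSpace.basisFun (Fin 3) ℝ m), fderiv ℝ V x (EuclideanSpace.basisFun (Fin 3) ℝ m)⟫) * (∑ m : Fin 3, ⟪fderiv ℝ V x (EuclideanSpace.basisFun (Fin 3) ℝ m), fderiv ℝ V x (EuclideanSpace.basisFun (Fin 3) ℝ m)⟫))) volume := by
    refine (i1.const_mul (9 * K * B ^ 2)).mono' (cγ.continuous.mul (cSx.mul cSx)).aestronglyMeasurable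
      (Eventually.of_forall fun x => ?_)
    rw [Real.norm_eq_abs, abs_of_nonneg (mul_nonneg (hγ0 _) (mul_nonneg (hSnn x) (hSnn x)))]
    have a2 := hSle x; have a5 := hγK (x 2); have a6 := hγ0 (x 2); have a7 := hPB x; have a8 := hSnn x
    calc γ (x 2) * ((∑ m : Fin 3, ⟪fderiv ℝ V x (EuclideanSpace.basisFun (Fin 3) ℝ m), fderiv ℝ V x (EuclideanSpace.basisFun (Fin 3) ℝ m)⟫) * (∑ m : Fin 3, ⟪fderiv ℝ V x (EuclideanSpace.basisFun (Fin 3) ℝ m), fderiv ℝ V x (EuclideanSpace.basisFun (Fin 3) ℝ m)⟫)) ≤ K * ((3 * ‖fderiv ℝ V x‖ ^ 2) * (3 * B ^ 2)) :=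
          mul_le_mul a5 (mul_le_mul a2 (a2.trans (by nlinarith)) a8 (by positivity)) (by positivity) hK0
      _ = 9 * K * B ^ 2 * ‖fderiv ℝ V x‖ ^ 2 := by ring
  have iS : Integrable (fun x : EuclideanSpace ℝ (Fin 3) => γ (x 2) * (∑ m : Fin 3, ⟪fderiv ℝ V x (EuclideanSpace.basisFun (Fin 3) ℝ m), fderiv ℝ V x (EuclideanSpace.basisFun (Fin 3) ℝ m)⟫)) volume := by
    refine (i1.const_mul (3 * K)).mono' (cγ.continuous.mul cSx).aestronglyMeasurable (Eventually.of_forall fun x => ?_)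
    rw [Real.norm_eq_abs, abs_of_nonneg (mul_nonneg (hγ0 _) (hSnn x))]
    calc γ (x 2) * (∑ m : Fin 3, ⟪fderiv ℝ V x (EuclideanSpace.basisFun (Fin 3) ℝ m), fderiv ℝ V x (EuclideanSpace.basisFun (Fin 3) ℝ m)⟫) ≤ K * (3 * ‖fderiv ℝ V x‖ ^ 2) := mul_le_mul (hγK _) (hSle x) (hSnn x) hK0
      _ = 3 * K * ‖fderiv ℝ V x‖ ^ 2 := by ring
  have iQ : Integrable (fun x : EuclideanSpace ℝ (Fin 3) => γ (x 2) * ‖iteratedFDeriv ℝ 2 V x‖ ^ 2) volume := by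
    refine (i2.const_mul K).mono' (cγ.continuous.mul (cQ.pow 2)).aestronglyMeasurable (Eventually.of_forall fun x => ?_)
    rw [Real.norm_eq_abs, abs_of_nonneg (mul_nonneg (hγ0 _) (sq_nonneg _))]
    exact mul_le_mul_of_nonneg_right (hγK _) (sq_nonneg _)
  have iG : Integrable (fun x : EuclideanSpace ℝ (Fin 3) => (3 * (σ / L) ^ 2 * (γ (x 2) * (∑ m : Fin 3, ⟪fderiv ℝ V x (EuclideanSpace.basisFun (Fin 3) ℝ m), fderiv ℝ V x (EuclideanSpace.basisFun (Fin 3) ℝ m)⟫)) + 81 * σ ^ 2 * (γ (x 2) * ‖iteratedFDeriv ℝ 2 V x‖ ^ 2))) volume := (iS.const_mul _).add (iQ.const_mul _)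
  have idiv : Integrable (fun x : EuclideanSpace ℝ (Fin 3) => VectorCalculus.divergence (fun y : EuclideanSpace ℝ (Fin 3) => ∑ k : Fin 3, (γ (y 2) * ((∑ m : Fin 3, ⟪fderiv ℝ V y (EuclideanSpace.basisFun (Fin 3) ℝ m), fderiv ℝ V y (EuclideanSpace.basisFun (Fin 3) ℝ m)⟫) * ⟪V y, fderiv ℝ V y (EuclideanSpace.basisFun (Fin 3) ℝ k)⟫)) • EuclideanSpace.basisFun (Fin 3) ℝ k) x) volume := by
    have cdiv : Continuous fun x : EuclideanSpace ℝ (Fin 3) => VectorCalculus.divergence (fun y : EuclideanSpace ℝ (Fin 3) => ∑ k : Fin 3, (γ (y 2) * ((∑ m : Fin 3, ⟪fderiv ℝ V y (EuclideanSpace.basisFun (Fin 3) ℝ m), fderiv ℝ V y (EuclideanSpace.basisFun (Fin 3) ℝ m)⟫) * ⟪V y, fderiv ℝ V y (EuclideanSpace.basisFun (Fin 3) ℝ k)⟫)) • EuclideanSpace.basisFun (Fin 3) ℝ k) x :=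
      (traceCLM (E := EuclideanSpace ℝ (Fin 3))).continuous.comp (hX1.continuous_fderiv one_ne_zero)
    refine (((iSS.const_mul (3 / 2)).add iG)).mono' cdiv.aestronglyMeasurable (Eventually.of_forall fun x => ?_)
    simp only [Pi.add_apply]
    have h1 := hRest x
    have h2 : 0 ≤ γ (x 2) * ((∑ m : Fin 3, ⟪fderiv ℝ V x (EuclideanSpace.basisFun (Fin 3) ℝ m), fderiv ℝ V x (EuclideanSpace.basisFun (Fin 3) ℝ m)⟫) * (∑ m : Fin 3, ⟪fderiv ℝ V x (EuclideanSpace.basisFun (Fin 3) ℝ m), fderiv ℝ V x (EuclideanSpace.basisFun (Fin 3) ℝ m)⟫)) := mul_nonneg (hγ0 _) (mul_nonneg (hSnn x) (hSnn x))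
    rw [Real.norm_eq_abs]
    have h3 := abs_sub_abs_le_abs_sub (VectorCalculus.divergence (fun y : EuclideanSpace ℝ (Fin 3) => ∑ k : Fin 3, (γ (y 2) * ((∑ m : Fin 3, ⟪fderiv ℝ V y (EuclideanSpace.basisFun (Fin 3) ℝ m), fderiv ℝ V y (EuclideanSpace.basisFun (Fin 3) ℝ m)⟫) * ⟪V y, fderiv ℝ V y (EuclideanSpace.basisFun (Fin 3) ℝ k)⟫)) • EuclideanSpace.basisFun (Fin 3) ℝ k) x) (γ (x 2) * ((∑ m : Fin 3, ⟪fderiv ℝ V x (EuclideanSpace.basisFun (Fin 3) ℝ m), fderiv ℝ V x (EuclideanSpace.basisFun (Fin 3) ℝ m)⟫) * (∑ m : Fin 3, ⟪fderiv ℝ V x (EuclideanSpace.basisFun (Fin 3) ℝ m), fderiv ℝ V x (EuclideanSpace.basisFun (Fin 3) ℝ m)⟫)))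
    rw [abs_of_nonneg h2] at h3
    linarith
  -- integrate `½γS² ≤ div X + G`
  have h0 := integral_divergence_eq_zero_of_integrable hX1 iX idiv
  have iDG : Integrable (fun x : EuclideanSpace ℝ (Fin 3) => VectorCalculus.divergence (fun y : EuclideanSpace ℝ (Fin 3) => ∑ k : Fin 3, (γ (y 2) * ((∑ m : Fin 3, ⟪fderiv ℝ V y (EuclideanSpace.basisFun (Fin 3) ℝ m), fderiv ℝ V y (EuclideanSpace.basisFun (Fin 3) ℝ m)⟫) * ⟪V y, fderiv ℝ V y (EuclideanSpace.basisFun (Fin 3) ℝ k)⟫)) • EuclideanSpace.basisFun (Fin 3) ℝ k) x + (3 * (σ / L) ^ 2 * (γ (x 2) * (∑ m : Fin 3, ⟪fderiv ℝ V x (EuclideanSpace.basisFun (Fin 3) ℝ m), fderiv ℝ V x (EuclideanSpace.basisFun (Fin 3) ℝ m)⟫)) + 81 * σ ^ 2 * (γ (x 2) * ‖iteratedFDeriv ℝ 2 V x‖ ^ 2))) volume := idiv.add iG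
  have hmono := integral_mono (iSS.const_mul (1 / 2)) iDG fun x => half x
  have e1 : (∫ x : EuclideanSpace ℝ (Fin 3), VectorCalculus.divergence (fun y : EuclideanSpace ℝ (Fin 3) => ∑ k : Fin 3, (γ (y 2) * ((∑ m : Fin 3, ⟪fderiv ℝ V y (EuclideanSpace.basisFun (Fin 3) ℝ m), fderiv ℝ V y (EuclideanSpace.basisFun (Fin 3) ℝ m)⟫) * ⟪V y, fderiv ℝ V y (EuclideanSpace.basisFun (Fin 3) ℝ k)⟫)) • EuclideanSpace.basisFun (Fin 3) ℝ k) x + (3 * (σ / L) ^ 2 * (γ (x 2) * (∑ m : Fin 3, ⟪fderiv ℝ V x (EuclideanSpace.basisFun (Fin 3) ℝ m), fderiv ℝ V x (EuclideanSpace.basisFun (Fin 3) ℝ m)⟫)) + 81 * σ ^ 2 * (γ (x 2) * ‖iteratedFDeriv ℝ 2 V x‖ ^ 2))) = (∫ x : EuclideanSpace ℝ (Fin 3), VectorCalculus.divergence (fun y : EuclideanSpace ℝ (Fin 3) => ∑ k : Fin 3, (γ (y 2) * ((∑ m : Fin 3, ⟪fderiv ℝ V y (EuclideanSpace.basisFun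 (Fin 3) ℝ m), fderiv ℝ V y (EuclideanSpace.basisFun (Fin 3) ℝ m)⟫) * ⟪V y, fderiv ℝ V y (EuclideanSpace.basisFun (Fin 3) ℝ k)⟫)) • EuclideanSpace.basisFun (Fin 3) ℝ k) x) + ∫ x : EuclideanSpace ℝ (Fin 3), (3 * (σ / L) ^ 2 * (γ (x 2) * (∑ m : Fin 3, ⟪fderiv ℝ V x (EuclideanSpace.basisFun (Fin 3) ℝ m), fderiv ℝ V x (EuclideanSpace.basisFun (Fin 3) ℝ m)⟫)) + 81 * σ ^ 2 * (γ (x 2) * ‖iteratedFDeriv ℝ 2 V x‖ ^ 2)) := integral_add idiv iG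
  have iS' : Integrable (fun x : EuclideanSpace ℝ (Fin 3) => 3 * (σ / L) ^ 2 * (γ (x 2) * (∑ m : Fin 3, ⟪fderiv ℝ V x (EuclideanSpace.basisFun (Fin 3) ℝ m), fderiv ℝ V x (EuclideanSpace.basisFun (Fin 3) ℝ m)⟫))) volume := iS.const_mul _
  have iQ' : Integrable (fun x : EuclideanSpace ℝ (Fin 3) => 81 * σ ^ 2 * (γ (x 2) * ‖iteratedFDeriv ℝ 2 V x‖ ^ 2)) volume := iQ.const_mul _
  have e2 : (∫ x : EuclideanSpace ℝ (Fin 3), (3 * (σ / L) ^ 2 * (γ (x 2) * (∑ m : Fin 3, ⟪fderiv ℝ V x (EuclideanSpace.basisFun (Fin 3) ℝ m), fderiv ℝ V x (EuclideanSpace.basisFun (Fin 3) ℝ m)⟫)) + 81 * σ ^ 2 * (γ (x 2) * ‖iteratedFDeriv ℝ 2 V x‖ ^ 2))) = (∫ x : EuclideanSpace ℝ (Fin 3), 3 * (σ / L) ^ 2 * (γ (x 2) * (∑ m : Fin 3, ⟪fderiv ℝ V x (EuclideanSpace.basisFun (Fin 3) ℝ m), fderiv ℝ V x (EuclideanSpace.basisFun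 (Fin 3) ℝ m)⟫))) + ∫ x : EuclideanSpace ℝ (Fin 3), 81 * σ ^ 2 * (γ (x 2) * ‖iteratedFDeriv ℝ 2 V x‖ ^ 2) :=
    integral_add iS' iQ'
  have e3 : (∫ x : EuclideanSpace ℝ (Fin 3), 3 * (σ / L) ^ 2 * (γ (x 2) * (∑ m : Fin 3, ⟪fderiv ℝ V x (EuclideanSpace.basisFun (Fin 3) ℝ m), fderiv ℝ V x (EuclideanSpace.basisFun (Fin 3) ℝ m)⟫))) = 3 * (σ / L) ^ 2 * ∫ x : EuclideanSpace ℝ (Fin 3), γ (x 2) * (∑ m : Fin 3, ⟪fderiv ℝ V x (EuclideanSpace.basisFun (Fin 3) ℝ m), fderiv ℝ V x (EuclideanSpace.basisFun (Fin 3) ℝ m)⟫) :=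
    integral_const_mul _ _
  have e4 : (∫ x : EuclideanSpace ℝ (Fin 3), 81 * σ ^ 2 * (γ (x 2) * ‖iteratedFDeriv ℝ 2 V x‖ ^ 2)) = 81 * σ ^ 2 * ∫ x : EuclideanSpace ℝ (Fin 3), γ (x 2) * ‖iteratedFDeriv ℝ 2 V x‖ ^ 2 :=
    integral_const_mul _ _
  have e5 : (∫ x : EuclideanSpace ℝ (Fin 3), 1 / 2 * (γ (x 2) * ((∑ m : Fin 3, ⟪fderiv ℝ V x (EuclideanSpace.basisFun (Fin 3) ℝ m), fderiv ℝ V x (EuclideanSpace.basisFun (Fin 3) ℝ m)⟫) * (∑ m : Fin 3, ⟪fderiv ℝ V x (EuclideanSpace.basisFun (Fin 3) ℝ m), fderiv ℝ V x (EuclideanSpace.basisFun (Fin 3) ℝ m)⟫)))) = 1 / 2 * ∫ x : EuclideanSpace ℝ (Fin 3), γ (x 2) * ((∑ m : Fin 3, ⟪fderiv ℝ V x (EuclideanSpace.basisFun (Fin 3) ℝ m), fderiv ℝ V x (EuclideanSpace.basisFun (Fin 3) ℝ m)⟫) * (∑ m : Fin 3, ⟪fderiv ℝ V x (EuclideanSpace.basisFun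 (Fin 3) ℝ m), fderiv ℝ V x (EuclideanSpace.basisFun (Fin 3) ℝ m)⟫)) :=
    integral_const_mul _ _
  have e6 : (∫ x : EuclideanSpace ℝ (Fin 3), γ (x 2) * (∑ m : Fin 3, ⟪fderiv ℝ V x (EuclideanSpace.basisFun (Fin 3) ℝ m), fderiv ℝ V x (EuclideanSpace.basisFun (Fin 3) ℝ m)⟫) ^ 2) = ∫ x : EuclideanSpace ℝ (Fin 3), γ (x 2) * ((∑ m : Fin 3, ⟪fderiv ℝ V x (EuclideanSpace.basisFun (Fin 3) ℝ m), fderiv ℝ V x (EuclideanSpace.basisFun (Fin 3) ℝ m)⟫) * (∑ m : Fin 3, ⟪fderiv ℝ V x (EuclideanSpace.basisFun (Fin 3) ℝ m), fderiv ℝ V x (EuclideanSpace.basisFun (Fin 3) ℝ m)⟫)) :=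
    integral_congr_ae (Eventually.of_forall fun x => by dsimp only; ring)
  rw [e6]
  simp only [e1, h0, e2, e3, e4, e5, zero_add] at hmono
  linarith

end ExtremiserLiouville

end Summit.NavierStokesRegularity.NavierStokesRegularity.Theorems

end
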